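import Summits.Ventures.WeilGRH.UniformConductorFloorMinorant
import HarnessLib

/-!
# GRH arm (rh-explicit, venture WeilGRH): joint cell certificates on the grid `δ = 2 log(R/(R−1))` — data format and checker

Cell `rh-explicit`, WEIL TRACK — GRH ARM (weil-grh-1).  DEFINITIONS ONLY (the soundness theorems are in
`UniformConductorFloorJointCertSound*.lean`, the data in `UniformConductorFloorJointData*.lean`).

A `JointCert` is integer data for the hypotheses of `UniformFloor.weilPositivityOnChar_of_joint_cert` on the r-ADIC GRID:
`r = (R−1)/R`, cell width `δ = 2 log(R/(R−1)) = −2 log r`, `J` cells, window `t = Jδ/2`, parity `κ` (`x = ¼ + κ/2`),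
`M` Lévy layers with `4(m + x) = a_m := 4m + 1 + 2κ ∈ ℕ`, slabs `k0 ≤ k < J` (pairs vanish beyond `J`; the constant uses
`k0 ≤ k < K`).  On this grid every archimedean slab mass is RATIONAL:
`∫_{kδ}^{(k+1)δ} e^{−2(m+x)u} du = (2/a_m)(r^{a_m k} − r^{a_m(k+1)})`, so the whole certificate is checked in `ℕ`:

* `phi` (the Collatz–Wielandt vector, `1 ≤ φ_j ≤ PhiMax`), `shifts`/`weights` (`s_n`, `W_n` for `n ≤ N`; `W_n/D ≥ Λ(n)/√n` is
  proved OUTSIDE the checker from the tree's decimal bounds), `slabB` (`B_i/D ≥ I_{k0+i}`, checked EXACTLY against the rational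
  value with a common denominator `R^E·L`, `L` a common multiple of the `a_m`), `Clow` (`Clow/D ≤ 2Σ_{k0≤k<K} I_k`, checked
  exactly), `RHO` (`ρ = RHO/D`);
* `checkCells` runs the `J` cell inequalities `Σ_n W_n·pair(s_n, j) + Σ_i B_i·pair(k0+i, j) ≤ RHO·φ_j` with a ZIPPER (the two
  slab correlations are dot products against a reversed-prefix list and a suffix list updated in `O(1)` per cell, total `O(J²)`);
  `cellOKB` is the per-cell specification it is proved equal to;
* `checkShifts` (`n(R−1)^{2s} ≥ R^{2s}`, `n(R−1)^{2s+2} ≤ R^{2s+2}` ⇔ `s_nδ ≤ log n ≤ (s_n+1)δ`), `checkWindow`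
  (`(N+1)(R−1)^{2J} ≥ R^{2J}` ⇔ `e^{2t} ≤ N+1`), `checkOne` (`e·r^J ≤ 1` ⇔ `t ≥ 1`, via `e < 2.7182818286`).

The real-number interpretation (`JointCert.r/δ/t/φ/wbar/sfun/Ibar/ρ`) is defined here too.  No theorems; no named facts.

## References

* L. Collatz (1942) / H. Wielandt (1950), the quotient bound for non-negative operators. [folklore]
-/

noncomputable section

open Real MeasureTheory

namespace Summit.Ventures.WeilGRH

namespace UniformFloor

/-- Dot product of two lists of naturals, truncated to the shorter one. [folklore] -/
def dotN : List ℕ → List ℕ → ℕ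
  | a :: as, b :: bs => a * b + dotN as bs
  | _, _ => 0

/-- **Joint cell certificate** (integer data; semantics in the module docstring and in `JointCert.r`, `.δ`, `.t`, `.φ`,
`.wbar`, `.sfun`, `.Ibar`, `.ρ`). [folklore] -/
structure JointCert where
  /-- grid base: `r = (R−1)/R`, `δ = 2 log(R/(R−1))` -/
  R : ℕ
  /-- number of cells; window `t = Jδ/2` -/
  J : ℕ
  /-- parity `κ ∈ {0, 1}` (`x = ¼ + κ/2`) -/
  κ : ℕ
  /-- number of Lévy layers -/
  M : ℕ
  /-- first slab (the part `|u| < k0 δ` of every layer is dropped) -/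
  k0 : ℕ
  /-- slab range end for the constant `2Σ_{k0≤k<K} I_k` (`J ≤ K`) -/
  K : ℕ
  /-- prime powers `n ≤ N` -/
  N : ℕ
  /-- common denominator of `weights`, `slabB`, `Clow`, `RHO` -/
  D : ℕ
  /-- a common multiple of the `a_m = 4m + 1 + 2κ`, `m < M` -/
  L : ℕ
  /-- the Collatz–Wielandt vector `φ_j`, `0 ≤ j < J` -/
  phi : List ℕ
  /-- an upper bound for the entries of `phi` -/
  PhiMax : ℕ
  /-- shift indices `s_n`, `n = 0 … N` -/
  shifts : List ℕ
  /-- prime weights `W_n` (`W_n/D ≥ Λ(n)/√n`), `n = 0 … N` -/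
  weights : List ℕ
  /-- slab masses `B_i` (`B_i/D ≥ I_{k0+i}`), `i < J − k0` -/
  slabB : List ℕ
  /-- `Clow/D ≤ 2 Σ_{k0 ≤ k < K} I_k` -/
  Clow : ℕ
  /-- `ρ = RHO/D` -/
  RHO : ℕ
  deriving Repr

namespace JointCert

variable (c : JointCert)

/-! ### Integer side: the checker -/

/-- `a_m = 4m + 1 + 2κ = 4(m + x)`. [folklore] -/
def aexp (m : ℕ) : ℕ := 4 * m + 1 + 2 * c.κ

/-- `φ` at an integer index (`0` off `[0, J)`, reading `phi` with default `0`). [folklore] -/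
def phiAt (i : ℤ) : ℕ := if i < 0 then 0 else c.phi.getD i.toNat 0

/-- `Mx(i) = max(φ_i, φ_{i+1})`. [folklore] -/
def mx (i : ℤ) : ℕ := max (c.phiAt i) (c.phiAt (i + 1))

/-- The pair weight of shift index `s` at cell `j`: `max(φ_{j−s−1}, φ_{j−s}) + max(φ_{j+s}, φ_{j+s+1})`. [folklore] -/
def pairAt (s : ℕ) (j : ℕ) : ℕ := c.mx ((j : ℤ) - s - 1) + c.mx ((j : ℤ) + s)

/-- The prime part of cell `j`: `Σ_{n ≤ N} W_n · pair(s_n, j)`. [folklore] -/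
def atomSum (j : ℕ) : ℕ :=
  ((List.range' 0 (c.N + 1)).map fun n ↦ c.weights.getD n 0 * c.pairAt (c.shifts.getD n 0) j).sum

/-- The reversed-prefix list at cell `j`: `[Mx(j−1−k0−i) : i < n]`. [folklore] -/
def lList (j n : ℕ) : List ℕ := (List.range' 0 n).map fun i : ℕ ↦ c.mx ((j : ℤ) - 1 - c.k0 - (i : ℤ))

/-- The suffix list at cell `j`: `[Mx(j+k0+i) : i < n]`. [folklore] -/
def rList (j n : ℕ) : List ℕ := (List.range' 0 n).map fun i : ℕ ↦ c.mx ((j : ℤ) + c.k0 + (i : ℤ))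

/-- The specification of cell `j`: `Σ_n W_n pair(s_n, j) + Σ_{i<J−k0} B_i [Mx(j−k0−i−1) + Mx(j+k0+i)] ≤ RHO·φ_j`
(the two slab sums as dot products against `lList j (J − k0 + j)` and `rList j (2J − j)`). [folklore] -/
def cellOKB (j : ℕ) : Bool :=
  decide (c.atomSum j + dotN c.slabB (c.lList j (c.J - c.k0 + j)) + dotN c.slabB (c.rList j (2 * c.J - j)) ≤
    c.RHO * c.phiAt j)

/-- The zipper over the cells `j, j+1, …, j+cnt−1` with running lists `(ll, rr)`. [folklore] -/
def cellsLoop : ℕ → ℕ → List ℕ → List ℕ → Bool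
  | _, 0, _, _ => true
  | j, cnt + 1, ll, rr =>
    decide (c.atomSum j + dotN c.slabB ll + dotN c.slabB rr ≤ c.RHO * c.phiAt j) &&
      cellsLoop (j + 1) cnt (c.mx ((j : ℤ) - c.k0) :: ll) rr.tail

/-- The cells `j0 ≤ j < j0 + cnt`, started from the specification lists at `j0`. [folklore] -/
def cellsRange (j0 cnt : ℕ) : Bool := c.cellsLoop j0 cnt (c.lList j0 (c.J - c.k0 + j0)) (c.rList j0 (2 * c.J - j0))

/-- All cells. [folklore] -/
def checkCells : Bool := c.cellsRange 0 c.J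

/-- Shape conditions. [folklore] -/
def checkShape : Bool :=
  decide (2 ≤ c.R) && decide (c.k0 < c.J) && decide (c.J ≤ c.K) && decide (c.κ ≤ 1) && decide (0 < c.D) &&
    decide (0 < c.M) && decide (c.phi.length = c.J) && decide (c.shifts.length = c.N + 1) &&
    decide (c.weights.length = c.N + 1) && decide (c.slabB.length = c.J - c.k0) && decide (0 < c.L) &&
    (List.range' 0 c.M).all fun m ↦ decide (c.L % c.aexp m = 0)

/-- `1 ≤ φ_j ≤ PhiMax` for every entry. [folklore] -/
def checkPhi : Bool := c.phi.all fun p ↦ decide (1 ≤ p) && decide (p ≤ c.PhiMax)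

/-- Shift conditions: `s_0 = 0` and, for `1 ≤ n ≤ N`, `R^{2s} ≤ n(R−1)^{2s}` and `n(R−1)^{2s+2} ≤ R^{2s+2}`
(`⇔ s_nδ ≤ log n ≤ (s_n+1)δ`). [folklore] -/
def checkShifts : Bool :=
  decide (c.shifts.getD 0 0 = 0) &&
    (List.range' 1 c.N).all fun n ↦
      decide (c.R ^ (2 * c.shifts.getD n 0) ≤ n * (c.R - 1) ^ (2 * c.shifts.getD n 0)) &&
        decide (n * (c.R - 1) ^ (2 * c.shifts.getD n 0 + 2) ≤ c.R ^ (2 * c.shifts.getD n 0 + 2))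

/-- The exact slab-mass test for slab `k = k0 + i`:
`B_i · L · R^E ≥ D · Σ_{m<M} (2L/a_m) (R−1)^{a_m k} (R^{a_m} − (R−1)^{a_m}) R^{E − a_m(k+1)}`, `E = a_{M−1}(k+1)`. [folklore] -/
def slabOK (i : ℕ) : Bool :=
  let k := c.k0 + i
  let E := c.aexp (c.M - 1) * (k + 1)
  decide (c.D * ((List.range' 0 c.M).map fun m ↦
      2 * (c.L / c.aexp m) * ((c.R - 1) ^ (c.aexp m * k) * (c.R ^ c.aexp m - (c.R - 1) ^ c.aexp m) *
        c.R ^ (E - c.aexp m * (k + 1)))).sum ≤ c.slabB.getD i 0 * c.L * c.R ^ E)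

/-- All slab masses. [folklore] -/
def checkSlabs : Bool := (List.range' 0 (c.J - c.k0)).all fun i ↦ c.slabOK i

/-- The exact constant test: with `A = a_{M−1} k0`,
`Clow·L·R^{A+K} + D·R^A·(R−1)^K·Σ_m 4L/a_m ≤ D·R^K·Σ_m (4L/a_m)(R−1)^{a_m k0} R^{A − a_m k0}`
(`⇒ Clow/D ≤ Σ_m (4/a_m)(r^{a_m k0} − r^K) ≤ 2Σ_{k0≤k<K} I_k`). [folklore] -/
def checkConst : Bool :=
  let A := c.aexp (c.M - 1) * c.k0
  decide (c.Clow * c.L * c.R ^ (A + c.K) + c.D * c.R ^ A * (c.R - 1) ^ c.K *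
      ((List.range' 0 c.M).map fun m ↦ 4 * (c.L / c.aexp m)).sum ≤
    c.D * c.R ^ c.K * ((List.range' 0 c.M).map fun m ↦
      4 * (c.L / c.aexp m) * ((c.R - 1) ^ (c.aexp m * c.k0) * c.R ^ (A - c.aexp m * c.k0))).sum)

/-- `e^{2t} ≤ N + 1` on the grid: `R^{2J} ≤ (N+1)(R−1)^{2J}`. [folklore] -/
def checkWindow : Bool := decide (c.R ^ (2 * c.J) ≤ (c.N + 1) * (c.R - 1) ^ (2 * c.J))

/-- `t ≥ 1` on the grid: `e · r^J ≤ 1` via `e < 2.7182818286`. [folklore] -/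
def checkOne : Bool := decide (27182818286 * (c.R - 1) ^ c.J ≤ 10000000000 * c.R ^ c.J)

/-- The whole certificate (the cells are kept separate: they are the expensive part and may be split). [folklore] -/
def checkFrame : Bool :=
  c.checkShape && c.checkPhi && c.checkShifts && c.checkSlabs && c.checkConst && c.checkWindow

/-- Frame and cells. [folklore] -/
def check : Bool := c.checkFrame && c.checkCells

/-! ### Real side: the interpretation -/

/-- `r = (R − 1)/R`. [folklore] -/
def r : ℝ := ((c.R : ℝ) - 1) / c.R

/-- The cell width `δ = 2 log(R/(R−1))`. [folklore] -/
def δ : ℝ := 2 * Real.log ((c.R : ℝ) / ((c.R : ℝ) - 1))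

/-- The window `t = Jδ/2`. [folklore] -/
def t : ℝ := (c.J : ℝ) * c.δ / 2

/-- The step vector as a real function on `ℤ` (`0` off `[0, J)`). [folklore] -/
def φ (i : ℤ) : ℝ := if 0 ≤ i ∧ i < (c.J : ℤ) then ((c.phi.getD i.toNat 0 : ℕ) : ℝ) else 0

/-- The shift indices as a total function. [folklore] -/
def sfun (n : ℕ) : ℕ := c.shifts.getD n 0

/-- The prime weights `w̄_n = W_n/D`. [folklore] -/
def wbar (n : ℕ) : ℝ := ((c.weights.getD n 0 : ℕ) : ℝ) / c.D

/-- The slab-mass bounds: `B_{k−k0}/D` for `k < J`, the exact mass beyond. [folklore] -/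
def Ibar (k : ℕ) : ℝ :=
  if k < c.J then ((c.slabB.getD (k - c.k0) 0 : ℕ) : ℝ) / c.D
  else ∑ m ∈ Finset.range c.M, ∫ u in ((k : ℝ) * (2 * c.t / c.J))..(((k : ℝ) + 1) * (2 * c.t / c.J)),
    Real.exp (-(2 * ((m : ℝ) + (1 / 4 + (c.κ : ℝ) / 2)) * |u|))

/-- `ρ = RHO/D`. [folklore] -/
def ρ : ℝ := (c.RHO : ℝ) / c.D

end JointCert

end UniformFloor

end Summit.Ventures.WeilGRH

end
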